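import Summits.PneNP.PneNP.Theses.CanonicalForms

/-!
# Route CanonicalForms — `SamplerIdentity` (stmt-PneNP-0953)

"Canonizers are exact samplers": if `c` is a canonical form for the left-coset relation of `H ≤ G` (`c g ∈ gH`, constant on
cosets) then `e(g) := g⁻¹ c(g)` maps every coset bijectively onto `H`, so every `h ∈ H` has exactly `[G:H]` preimages:
`#{g | g⁻¹ c(g) = h} · |H| = |G|`. Proof: `{g | g⁻¹ c(g) = h} ≃ G ⧸ H` via `g ↦ gH`, with inverse `q ↦ c(q.out) · h⁻¹`, and
Lagrange.
-/

set_option linter.dupNamespace false -- `Summit.PneNP.PneNP.…`: summit = sub-problem name (D-0017 single-conjunct layout)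

namespace Summit.PneNP.PneNP.Theorems

/-- **Support item `SamplerIdentity` of route CanonicalForms (stmt-PneNP-0953)**: for a canonical form `c` of the left
cosets of `H` (`g⁻¹ c g ∈ H`, `c` constant on cosets) and every `h ∈ H`,
`Nat.card {g // g⁻¹ * c g = h} * Nat.card H = Nat.card G` — one solution per coset, then Lagrange. [folklore] -/
theorem canonicalForms_samplerIdentity_proof : Summit.PneNP.PneNP.Theses.CanonicalForms.SamplerIdentity := by
  unfold Summit.PneNP.PneNP.Theses.CanonicalForms.SamplerIdentity
  intro G _ _ H c hmem hconst h hh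
  -- `c g = g * (g⁻¹ * c g)`; on a solution `g`, `c g = g * h`
  have hsol : ∀ g : G, g⁻¹ * c g = h → c g = g * h := fun g hg => by
    rw [← hg, mul_inv_cancel_left]
  -- the candidate solution in the coset of `r`
  have hcand_mem : ∀ r : G, r⁻¹ * (c r * h⁻¹) ∈ H := fun r => by
    rw [← mul_assoc]
    exact H.mul_mem (hmem r) (H.inv_mem hh)
  have hcand : ∀ r : G, (c r * h⁻¹)⁻¹ * c (c r * h⁻¹) = h := fun r => by
    rw [← hconst r (c r * h⁻¹) (hcand_mem r), mul_inv_rev, inv_inv, mul_assoc, inv_mul_cancel, mul_one]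
  let E : {g : G // g⁻¹ * c g = h} ≃ G ⧸ H :=
    { toFun := fun g => (g.1 : G ⧸ H)
      invFun := fun q => ⟨c q.out * h⁻¹, hcand q.out⟩
      left_inv := by
        rintro ⟨g, hg⟩
        apply Subtype.ext
        show c (Quotient.out (g : G ⧸ H)) * h⁻¹ = g
        have hr : (Quotient.out (g : G ⧸ H))⁻¹ * g ∈ H := QuotientGroup.eq.1 (Quotient.out_eq _)
        rw [hconst _ g hr, hsol g hg, mul_inv_cancel_right]
      right_inv := by
        intro q
        show ((c q.out * h⁻¹ : G) : G ⧸ H) = q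
        conv_rhs => rw [← Quotient.out_eq q]
        exact (QuotientGroup.eq.2 (hcand_mem q.out)).symm }
  rw [Nat.card_congr E, Subgroup.card_eq_card_quotient_mul_card_subgroup H]

end Summit.PneNP.PneNP.Theorems
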